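import Summits.ValiantsHypothesis.ValiantsHypothesis.Theorems.NewtonUnitEquationsTwoProductsRankOneOneSidedLawFree
import HarnessLib

/-!
# Route NewtonUnitEquations — crux `TwoProducts` (stmt-ValiantsHypothesis-5906), line `relation_ladder`, rung R8 (ONE-SIDED rank one
# `p•α = Σ_i q_i•β_i`, any number of plus letters): the DILATED FREE LIFT with a plus-letter SET — part 2/6 — the multinomial regrouping and THE COEFFICIENT THEOREM for the slice functions `F_b` (T3 end, T4)

Part 2: `Pfac`, `kap`, `multinomial_Lof_eq`, `coeff_phiT_frM`; the slice layer `sB`, `ind`, `lam`, `restProd`, `gd`, `plusProd`, `mainConst`,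
`mainTerm`, `corr`, `Fsl`; `Fsl_xhat_eq`; **`coeff_free_logTrunc`**: `coeff_x φ_{frM}(logTrunc R) = (-1)^{deg x+1} · Pfac x · F_{x|B}(x̂)` (`deg x̂ ≥ 1`).

THE ONE-SIDED RANK-ONE LAW `p•α = Σ_{i<k} q_i•β_i` (R8; all `p, q_i ≥ 1`, distinct letters, every additive coincidence of the letter
family a multiple of this one relation): GLOBALLY `#visible ≤ 2^{c m}(#T + 2)^c` (`c = 1732`).  Engine (val-idea-8 g3's memo
`Cruxes/TwoProducts/Lines/relation_ladder_R8_engine.md` rev 2, typed target `Lines/relation_ladder_sketch_R8.lean :: R8.RankOneOneSidedLaw`,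
slice count `Lines/relation_ladder_R8_simplex.lean` = landed `…RankOneSimplexCount`): the DILATED FREE LIFT `α ↦ ∏ Y_j^{q_j}`, `Y_j ↦ Y_j^p` on
the plus letters, identity elsewhere, over the `p`-dilated plane (`enumP : j ↦ enum j` on the plus letters, `i ↦ p•enum i` otherwise); fibres
`k = #α` with divisibility guards `p ∣ x_j − q_j k`; letter count `B_k = k + Σ_j (x_j − q_j k)/p`; SLICING by the whole plus-letter exponent
vector `b = x|_B`; the coefficient theorem with `Pfac · C(R + B_k − 1, B_k) · κ_k`; finite SHIFT RANK `2m(Σb + 1)² + 1` and val-lit-p3's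
`ShiftRank.pencilCount` BY NAME; the slices of the visible points factor through the restricted letter multisets `L₀|_{a ∪ B}` (`deg L₀ ≤ m`),
counted by the simplex bound `#W ≤ 2^{n+k}` (`R8.card_W_le`); WIDE plus sides (`k > m + 1`), large (`> m`) or absent coefficients/letters are
permutation type (R3♯).  `k = 1` is R7c (`R7b.rankOneTwoLaw_proof`), `k = 2` is R7b (`R7b.rankOneThreeGenLaw_proof`).

AUTHORSHIP / LANE NOTE (val-lit-p3 g15, prover seat, helper mode `--supports stmt-ValiantsHypothesis-5906 --as helper`; CLAIM-FIRST #2 on the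
val-lit bus 12:55Z, silence = GO 13:30Z, no objection; the line owner val-idea-8 g3 CLOSED 12:24Z leaving R8 as a typed target + memo): part 2/6.
The STATEMENT is val-idea-8 g3's typed `R8.RankOneOneSidedLaw` (landed here by its LITERAL BODY, `OneSidedRankOne` unfolded — parameter-free
`def … : Prop` are not declared in Theorems files); the engine follows g3's memo decl-by-decl as a generalisation of the landed R7b REV 2 port
(`…RankOneThreeGenLaw*`, namespace `R7b`); the Lean text of this module is this seat's.  Reused BY NAME: `R6b.HSD` (+ closure lemmas),
`R7b.dilE`/`R7b.piT_dilE`/`R7b.piE_dilE`, `R7a.permType_of_rankOne_largeCoeff/absent`, `toolBound_mono`, `tab`, `sgn`, `R6b.sum_sgn`,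
`PlanarCell.eq_of_nsmul_eq`, `FormalLogLinearisation.wt_nsmul`, `R8.card_W_le` (simplex).  Namespace `…PermutationType.R8` (the typed target's).
Nothing here closes the line's residual (`ResidualLawV20`), the crux `TwoProducts` (5906) or `VP ≠ VNP`; no summit statement is proved.

Honest scope: TWO-SIDED relations with ≥ 2 letters on each side (e.g. `α+2β = γ+δ`, val-neg-1 g4's p635912) and coincidence rank ≥ 2 are NOT
covered.  Nothing here moves VP ≠ VNP; `TwoProducts` (5906) / `PlanarCellBound` stay OPEN. [folklore]
-/

noncomputable section

-- Sub = Summit single-conjunct layout: the duplicated namespace component is mandated by the tree.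
set_option linter.dupNamespace false
set_option linter.unusedSimpArgs false
set_option linter.unusedSectionVars false
set_option linter.unusedVariables false

namespace Summit.ValiantsHypothesis.ValiantsHypothesis.Theorems.NewtonUnitEquations.TwoProducts.PermutationType
namespace R8
open scoped BigOperators
open MvPolynomial

variable {σ : Type*} [Fintype σ] [DecidableEq σ]

variable (Io : OIdx σ)
/-- The slice normaliser `(R - 1)! / ∏_{rest} x_j!` (nonzero). [folklore] -/
def Pfac (x : σ →₀ ℕ) : ℂ :=
  (((deg (xhat Io x) - 1).factorial : ℕ) : ℂ) / (((∏ j ∈ rest Io, (x j).factorial : ℕ)) : ℂ)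

/-- The slice normaliser is nonzero. [folklore] -/
theorem Pfac_ne_zero (x : σ →₀ ℕ) : Pfac Io x ≠ 0 := by
  unfold Pfac
  refine div_ne_zero (Nat.cast_ne_zero.mpr (Nat.factorial_ne_zero _)) (Nat.cast_ne_zero.mpr ?_)
  exact Finset.prod_ne_zero_iff.mpr fun j _ => Nat.factorial_ne_zero _

/-- The fibre constant `κ_k = B_k! / (k! ∏_{j ∈ B} ((b j − qf j k)/p)!)`. [folklore] -/
def kap (b : σ → ℕ) (k : ℕ) : ℂ :=
  (((Bk Io b k).factorial : ℕ) : ℂ) /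
    (((k.factorial * ∏ j ∈ B Io, ((b j - Io.qf j * k) / Io.p).factorial : ℕ)) : ℂ)

/-- (F5) **Multinomial regrouping along the fibre**:
`multinomial(L_k) = Pfac(x) · C(R + B_k − 1, B_k) · κ_k · deg(L_k)` for `R = deg x̂ ≥ 1`. [folklore] -/
theorem multinomial_Lof_eq (x : σ →₀ ℕ) (k : ℕ) (hk : k ∈ KR Io x) (h1 : 1 ≤ deg (xhat Io x)) :
    ((Lof Io x k).multinomial : ℂ) =
      Pfac Io x * (((deg (xhat Io x) + Bk Io x k - 1).choose (Bk Io x k) : ℕ) : ℂ) *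
        kap Io x k * ((deg (Lof Io x k) : ℕ) : ℂ) := by
  have hdeg := deg_Lof_eq Io x k
  set D := deg (xhat Io x) with hD
  set Bq := Bk Io x k with hB
  set n := deg (Lof Io x k) with hn
  have sL := Nat.multinomial_spec (Finset.univ : Finset σ) (Lof Io x k)
  rw [← multinomial_univ, ← deg_eq_sum] at sL
  rw [prod_split Io, Lof_a] at sL
  have hr : ∏ j ∈ rest Io, ((Lof Io x k) j).factorial = ∏ j ∈ rest Io, (x j).factorial :=
    Finset.prod_congr rfl fun j hj => by rw [Lof_rest Io x k hj]
  have hb : ∏ j ∈ B Io, ((Lof Io x k) j).factorial = ∏ j ∈ B Io, ((x j - Io.qf j * k) / Io.p).factorial :=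
    Finset.prod_congr rfl fun j hj => by rw [Lof_B Io x k hj]
  rw [hr, hb, ← hn] at sL
  -- factorial identities
  have h2 : (D + Bq - 1).choose Bq * Bq.factorial * (D - 1).factorial = (D + Bq - 1).factorial := by
    have := Nat.choose_mul_factorial_mul_factorial (n := D + Bq - 1) (k := Bq) (by omega)
    rwa [show D + Bq - 1 - Bq = D - 1 by omega] at this
  have h3 : n.factorial = n * (D + Bq - 1).factorial := by
    rw [show n = (D + Bq - 1) + 1 by omega, Nat.factorial_succ]
  set P : ℂ := ∏ j ∈ rest Io, ((((x j).factorial : ℕ)) : ℂ) with hP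
  set Kd : ℂ := ((k.factorial : ℕ) : ℂ) * ∏ j ∈ B Io, (((((x j - Io.qf j * k) / Io.p).factorial : ℕ)) : ℂ) with hKd
  have hPne : P ≠ 0 := Finset.prod_ne_zero_iff.mpr fun j _ => Nat.cast_ne_zero.mpr (Nat.factorial_ne_zero _)
  have hKdne : Kd ≠ 0 :=
    mul_ne_zero (Nat.cast_ne_zero.mpr (Nat.factorial_ne_zero _))
      (Finset.prod_ne_zero_iff.mpr fun j _ => Nat.cast_ne_zero.mpr (Nat.factorial_ne_zero _))
  have key : ((Lof Io x k).multinomial : ℂ) * (P * Kd) =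
      (n : ℂ) * ((((D + Bq - 1).choose Bq : ℕ) : ℂ) * ((Bq.factorial : ℕ) : ℂ) * (((D - 1).factorial : ℕ) : ℂ)) := by
    have e : ((((∏ j ∈ rest Io, (x j).factorial) *
        (k.factorial * ∏ j ∈ B Io, ((x j - Io.qf j * k) / Io.p).factorial) *
        (Lof Io x k).multinomial : ℕ)) : ℂ) = ((n.factorial : ℕ) : ℂ) := by exact_mod_cast sL
    rw [h3, ← h2] at e
    push_cast at e
    rw [hP, hKd]
    linear_combination e
  have hPf : Pfac Io x = (((D - 1).factorial : ℕ) : ℂ) / P := by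
    unfold Pfac; rw [hP]; push_cast; rfl
  have hkap : kap Io x k = ((Bq.factorial : ℕ) : ℂ) / Kd := by
    unfold kap; rw [hKd, hB]; push_cast; rfl
  rw [hPf, hkap]
  calc ((Lof Io x k).multinomial : ℂ) = ((Lof Io x k).multinomial : ℂ) * (P * Kd) / (P * Kd) := by
        field_simp
    _ = (n : ℂ) * ((((D + Bq - 1).choose Bq : ℕ) : ℂ) * ((Bq.factorial : ℕ) : ℂ) * (((D - 1).factorial : ℕ) : ℂ)) / (P * Kd) := by
        rw [key]
    _ = (((D - 1).factorial : ℕ) : ℂ) / P * ((((D + Bq - 1).choose Bq : ℕ)) : ℂ) * (((Bq.factorial : ℕ) : ℂ) / Kd) * (n : ℂ) := by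
        field_simp

/-- Fibre sums of the substitution: `coeff_x (φ_M H) = Σ_{k ∈ KR x} coeff_{L_k} H` (for `x a = 0`). [folklore] -/
theorem coeff_phiT_frM (H : MvPolynomial σ ℂ) (x : σ →₀ ℕ) (hx : x Io.a = 0) :
    coeff x (phiT (frM Io) H) = ∑ k ∈ KR Io x, coeff (Lof Io x k) H := by
  classical
  rw [coeff_phiT]
  rw [← Finset.sum_filter_add_sum_filter_not (KR Io x) (fun k => Lof Io x k ∈ H.support)]
  rw [Finset.sum_eq_zero (s := (KR Io x).filter fun k => ¬ Lof Io x k ∈ H.support)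
    (fun k hk => notMem_support_iff.mp (Finset.mem_filter.mp hk).2), add_zero]
  apply Finset.sum_nbij' (fun L => L Io.a) (fun k => Lof Io x k)
  · intro L hL
    rw [Finset.mem_filter] at hL
    obtain ⟨-, hk, hLeq⟩ := eq_Lof_of_piT Io L x hL.2
    rw [Finset.mem_filter, ← hLeq]
    exact ⟨hk, hL.1⟩
  · intro k hk
    rw [Finset.mem_filter] at hk
    rw [Finset.mem_filter]
    exact ⟨hk.2, piT_Lof Io x hx k hk.1⟩
  · intro L hL
    rw [Finset.mem_filter] at hL
    exact (eq_Lof_of_piT Io L x hL.2).2.2.symm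
  · intro k _
    exact Lof_a Io x k
  · intro L hL
    rw [Finset.mem_filter] at hL
    obtain ⟨-, -, hLeq⟩ := eq_Lof_of_piT Io L x hL.2
    rw [← hLeq]

/-! ## Part T4: the slice functions `F_b` (slice vector `b` = the exponent on the plus letters) and THE COEFFICIENT THEOREM -/

section Slice
variable {m : ℕ}

/-- The total slice mass `Σ_{j ∈ B} b j`. [folklore] -/
def sB (b : σ → ℕ) : ℕ := ∑ j ∈ B Io, b j

/-- The slice indicator `[ν_a = 0] [ν_j = 0 for all plus letters j]`. [folklore] -/
def ind (ν : σ → ℕ) : ℂ := if ν Io.a = 0 ∧ ∀ j ∈ B Io, ν j = 0 then 1 else 0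

/-- The ADDITIVE letter-count form `λ(ν) = Σ_{rest} ν_j`. [folklore] -/
def lam (ν : σ → ℕ) : ℕ := ∑ j ∈ rest Io, ν j

/-- The exponential factor over the untouched letters. [folklore] -/
def restProd (t : σ → ℂ) (ν : σ → ℕ) : ℂ := ∏ j ∈ rest Io, t j ^ ν j

/-- The admissibility guard. [folklore] -/
def gd (b : σ → ℕ) (k : ℕ) : ℂ := if Adm Io b k then 1 else 0

/-- The plus-letter power product of an atom on the fibre element: `∏_{j ∈ B} t_j ^ ((b j − qf j k)/p)`. [folklore] -/
def plusProd (t : σ → ℂ) (b : σ → ℕ) (k : ℕ) : ℂ := ∏ j ∈ B Io, t j ^ ((b j - Io.qf j * k) / Io.p)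

/-- The `ν`-independent part of the `(j, k)` term:
`[admissible] · ± (-1)^{Σb + B_k} t_{ja}^k ∏_{i ∈ B} t_{ji}^{(b i - qf i k)/p} · κ_k`. [folklore] -/
def mainConst (c d : Fin m → σ → ℂ) (b : σ → ℕ) (j : Fin m ⊕ Fin m) (k : ℕ) : ℂ :=
  gd Io b k * (sgn m j * (-1) ^ (sB Io b + Bk Io b k) * tab c d j Io.a ^ k * plusProd Io (tab c d j) b k * kap Io b k)

/-- The `(j, k)` term of the slice function `F_b`: `mainConst · ∏_rest t_{je}^{ν_e} · C(λ(ν) + B_k - 1, B_k)`. [folklore] -/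
def mainTerm (c d : Fin m → σ → ℂ) (b : σ → ℕ) (j : Fin m ⊕ Fin m) (k : ℕ) (ν : σ → ℕ) : ℂ :=
  mainConst Io c d b j k * (restProd Io (tab c d j) ν * (((lam Io ν + (Bk Io b k - 1)).choose (Bk Io b k) : ℕ) : ℂ))

/-- The correction at the exceptional point `ν = 0` of the slice. [folklore] -/
def corr (c d : Fin m → σ → ℂ) (b : σ → ℕ) (ν : σ → ℕ) : ℂ :=
  if (∀ j, ν j = 0) then ∑ j : Fin m ⊕ Fin m, ∑ k : Fin (sB Io b + 1), mainConst Io c d b j k / ((Bk Io b k : ℕ) : ℂ) else 0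

/-- **The slice function** `F_b` of the dilated free lift of the truncated logarithm. [folklore] -/
def Fsl (c d : Fin m → σ → ℂ) (b : σ → ℕ) (ν : σ → ℕ) : ℂ :=
  ind Io ν * (∑ j : Fin m ⊕ Fin m, ∑ k : Fin (sB Io b + 1), mainTerm Io c d b j k ν) + corr Io c d b ν

/-- `λ` at a reduced exponent is its degree. [folklore] -/
theorem lam_xhat (x : σ →₀ ℕ) : lam Io ⇑(xhat Io x) = deg (xhat Io x) := by
  rw [deg_xhat]; unfold lam
  exact Finset.sum_congr rfl fun j hj => xhat_rest Io x hj

/-- The rest-product at a reduced exponent. [folklore] -/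
theorem restProd_xhat (t : σ → ℂ) (x : σ →₀ ℕ) : restProd Io t ⇑(xhat Io x) = ∏ j ∈ rest Io, t j ^ x j := by
  unfold restProd
  exact Finset.prod_congr rfl fun j hj => by rw [xhat_rest Io x hj]

/-- Moments along the fibre. [folklore] -/
theorem mom_Lof (t : σ → ℂ) (x : σ →₀ ℕ) (k : ℕ) :
    mom t (Lof Io x k) = t Io.a ^ k * plusProd Io t x k * restProd Io t ⇑(xhat Io x) := by
  unfold mom plusProd
  rw [prod_split Io, Lof_a, restProd_xhat]
  have hr : ∏ j ∈ rest Io, t j ^ (Lof Io x k) j = ∏ j ∈ rest Io, t j ^ x j :=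
    Finset.prod_congr rfl fun j hj => by rw [Lof_rest Io x k hj]
  have hb : ∏ j ∈ B Io, t j ^ (Lof Io x k) j = ∏ j ∈ B Io, t j ^ ((x j - Io.qf j * k) / Io.p) :=
    Finset.prod_congr rfl fun j hj => by rw [Lof_B Io x k hj]
  rw [hr, hb]; ring

/-- The slice indicator at a reduced exponent is `1`. [folklore] -/
theorem ind_xhat (x : σ →₀ ℕ) : ind Io ⇑(xhat Io x) = 1 := by
  unfold ind; rw [if_pos ⟨xhat_a Io x, fun j hj => xhat_B Io x hj⟩]

/-- The correction vanishes off the exceptional point. [folklore] -/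
theorem corr_xhat (c d : Fin m → σ → ℂ) (b : σ → ℕ) (x : σ →₀ ℕ) (h1 : 1 ≤ deg (xhat Io x)) :
    corr Io c d b ⇑(xhat Io x) = 0 := by
  unfold corr
  rw [if_neg]
  intro h
  have : xhat Io x = 0 := by ext j; exact h j
  rw [this] at h1
  simp [deg] at h1

/-- Guard of an admissible `k`. [folklore] -/
theorem gd_pos {b : σ → ℕ} {k : ℕ} (h : Adm Io b k) : gd Io b k = 1 := by
  unfold gd; rw [if_pos h]

/-- Guard of an inadmissible `k`. [folklore] -/
theorem gd_neg {b : σ → ℕ} {k : ℕ} (h : ¬ Adm Io b k) : gd Io b k = 0 := by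
  unfold gd; rw [if_neg h]

/-- The constants of an inadmissible `k` vanish. [folklore] -/
theorem mainConst_eq_zero (c d : Fin m → σ → ℂ) {b : σ → ℕ} {k : ℕ} (h : ¬ Adm Io b k) (j : Fin m ⊕ Fin m) :
    mainConst Io c d b j k = 0 := by
  unfold mainConst; rw [gd_neg Io h, zero_mul]

/-- `sB` of an exponent is its plus-letter mass. [folklore] -/
theorem sB_coe (x : σ →₀ ℕ) : sB Io ⇑x = ∑ j ∈ B Io, x j := rfl

/-- The atom sum of the `(·, k)` terms at a reduced point, `k` admissible. [folklore] -/
theorem sum_mainTerm_xhat (c d : Fin m → σ → ℂ) (x : σ →₀ ℕ) (h1 : 1 ≤ deg (xhat Io x)) (k : ℕ) (hk : k ∈ KR Io x) :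
    ∑ j, mainTerm Io c d x j k ⇑(xhat Io x) =
      (-1 : ℂ) ^ (sB Io x + Bk Io x k) *
        (((deg (xhat Io x) + Bk Io x k - 1).choose (Bk Io x k) : ℕ) : ℂ) *
          kap Io x k * (∑ j, mom (c j) (Lof Io x k) - ∑ j, mom (d j) (Lof Io x k)) := by
  have hk' := (mem_KR Io x k).1 hk
  rw [Fintype.sum_sum_type]
  simp only [mainTerm, mainConst, gd_pos Io hk', tab, sgn, Sum.elim_inl, Sum.elim_inr, lam_xhat,
    R7a.choose_bridge _ _ h1, mom_Lof Io _ x k]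
  rw [mul_sub, Finset.mul_sum, Finset.mul_sum, sub_eq_add_neg, ← Finset.sum_neg_distrib]
  congr 1
  · exact Finset.sum_congr rfl fun j _ => by ring
  · exact Finset.sum_congr rfl fun j _ => by ring

/-- The atom sum of the `(·, k)` terms vanishes for inadmissible `k`. [folklore] -/
theorem sum_mainTerm_xhat_zero (c d : Fin m → σ → ℂ) (x : σ →₀ ℕ) (k : ℕ) (hk : ¬ Adm Io x k) :
    ∑ j, mainTerm Io c d x j k ⇑(xhat Io x) = 0 := by
  refine Finset.sum_eq_zero fun j _ => ?_
  unfold mainTerm; rw [mainConst_eq_zero Io c d hk j, zero_mul]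

/-- The slice function at a reduced point is the fibre sum. [folklore] -/
theorem Fsl_xhat_eq (c d : Fin m → σ → ℂ) (x : σ →₀ ℕ) (h1 : 1 ≤ deg (xhat Io x)) :
    Fsl Io c d x ⇑(xhat Io x) = ∑ k ∈ KR Io x, (-1 : ℂ) ^ (sB Io x + Bk Io x k) *
        (((deg (xhat Io x) + Bk Io x k - 1).choose (Bk Io x k) : ℕ) : ℂ) *
          kap Io x k * (∑ j, mom (c j) (Lof Io x k) - ∑ j, mom (d j) (Lof Io x k)) := by
  unfold Fsl
  rw [ind_xhat, corr_xhat Io c d _ x h1, one_mul, add_zero, Finset.sum_comm]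
  rw [Fin.sum_univ_eq_sum_range (fun k => ∑ j, mainTerm Io c d x j k ⇑(xhat Io x)) (sB Io x + 1)]
  unfold KR
  rw [sB_coe, Finset.sum_filter]
  refine Finset.sum_congr rfl fun k _ => ?_
  by_cases hk : Adm Io x k
  · rw [if_pos hk]
    exact sum_mainTerm_xhat Io c d x h1 k ((mem_KR Io x k).2 hk)
  · rw [if_neg hk]
    exact sum_mainTerm_xhat_zero Io c d x k hk

/-- **THE COEFFICIENT THEOREM** (slice vector = the exponent on the plus letters). For `x` with `x_a = 0`, `R = deg x̂ ≥ 1` and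
`deg x ≤ R_t`: `coeff_x φ_frM(Λ_{R_t}) = (-1)^{deg x + 1} · Pfac(x) · F_x(x̂)`. [folklore] -/
theorem coeff_free_logTrunc (c d : Fin m → σ → ℂ) (R : ℕ) (x : σ →₀ ℕ) (hx : x Io.a = 0)
    (h1 : 1 ≤ deg (xhat Io x)) (hR : deg x ≤ R) :
    coeff x (phiT (frM Io) (logTrunc c d R)) =
      (-1 : ℂ) ^ (deg x + 1) * Pfac Io x * Fsl Io c d x ⇑(xhat Io x) := by
  classical
  rw [coeff_phiT_frM Io _ x hx]
  have hdx : deg x = deg (xhat Io x) + sB Io x := by rw [deg_eq_deg_xhat_add Io x, hx, zero_add]; rfl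
  have step2 : ∀ k ∈ KR Io x, coeff (Lof Io x k) (logTrunc c d R) =
      (-1 : ℂ) ^ (deg x + 1) * Pfac Io x * ((-1 : ℂ) ^ (sB Io x + Bk Io x k) *
        (((deg (xhat Io x) + Bk Io x k - 1).choose (Bk Io x k) : ℕ) : ℂ) *
          kap Io x k * (∑ j, mom (c j) (Lof Io x k) - ∑ j, mom (d j) (Lof Io x k))) := by
    intro k hk
    have hk' := (mem_KR Io x k).1 hk
    have hdeg := deg_Lof_eq Io x k
    have hBle : Bk Io x k ≤ sB Io x := Bk_le Io hk'
    have hdeg1 : 1 ≤ deg (Lof Io x k) := by omega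
    have hdegR : deg (Lof Io x k) ≤ R := by omega
    rw [coeff_logTrunc c d R _ hdeg1 hdegR, multinomial_Lof_eq Io x k hk h1]
    have hsign : (-1 : ℂ) ^ (deg (Lof Io x k) + 1) =
        (-1) ^ (deg x + 1) * (-1) ^ (sB Io x + Bk Io x k) := by
      have e : deg x + 1 + (sB Io x + Bk Io x k) = (deg (Lof Io x k) + 1) + 2 * sB Io x := by
        omega
      rw [← pow_add, e, pow_add (-1 : ℂ) (deg (Lof Io x k) + 1), pow_mul]
      norm_num
    have hn0 : ((deg (Lof Io x k) : ℕ) : ℂ) ≠ 0 := Nat.cast_ne_zero.mpr (by omega)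
    rw [hsign]
    field_simp
  rw [Finset.sum_congr rfl step2, ← Finset.mul_sum, Fsl_xhat_eq Io c d x h1]

end Slice

end R8
end Summit.ValiantsHypothesis.ValiantsHypothesis.Theorems.NewtonUnitEquations.TwoProducts.PermutationType

end
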